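import Summits.Ventures.DiscreteObjects.Hadamard.GramTwoSquares

/-!
# `668` is not a sum of two squares in `ℚ(√2)` (the norm obstruction for order-4 automorphisms of H(668))

Framing: lottery ticket; floor = certified bounds/negative ranges.

Cell pub-namedobj (venture DiscreteObjects), target (H), hadamard gen 13; number-theoretic input of the order-4 analysis of
FAMILY-F12-G13 §2 / HANDOFF-H-g13 item 1.  With `ℚ(√2)` modelled as Mathlib's `QuadraticAlgebra ℚ 2 0` (pairs `re + im·ω`,
`ω² = 2`):
* `even_padicValNat_sq_add_two_sq` — for `K = s² + 2r² > 0` the `167`-adic valuation of `K` is even (descent: `−2` is a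
  non-residue mod `167`, `167 ≡ 7 (mod 8)`);
* `rat_norm_obstruction_668` — there are no `a, b, c, d ∈ ℚ` with `ab + cd = 0` and `a² + c² + 2(b² + d²) = 668`
  (equivalently `668 ∉ N_{ℚ(√2, i)/ℚ(√2)}`): otherwise `668 = (a² + c²)(1 + 2t²)`, and `668·(den² + 2·num²)` would be a sum of two
  squares with odd `167`-adic valuation;
* `sqrtTwo_irrational_fact` (`r² ≠ 2` for `r ∈ ℚ`, so `QuadraticAlgebra ℚ 2 0` is a field) and
  **`not_sum_two_sq_668_sqrtTwo`**: `¬ ∃ u v : QuadraticAlgebra ℚ 2 0, u² + v² = 668`.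
Elementary; ours; no `sorry`.
-/

namespace Summit.Ventures.DiscreteObjects.Hadamard

open Finset BigOperators

/-- `−2` is not a square modulo `167` (`167 ≡ 7 (mod 8)`) -/
theorem neg_two_nonsquare_mod_167 : ∀ z : ZMod 167, z ^ 2 ≠ -2 := by
  haveI : Fact (Nat.Prime 167) := ⟨by norm_num⟩
  intro z hz
  have hns : ¬ IsSquare (-2 : ZMod 167) := by
    rw [ZMod.exists_sq_eq_neg_two_iff (by norm_num)]
    norm_num
  exact hns ⟨z, by rw [← hz]; ring⟩

/-- **Descent**: `167 ∣ s² + 2r²` forces `167 ∣ s` and `167 ∣ r`. -/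
theorem dvd_of_dvd_sq_add_two_sq {s r : ℕ} (h : 167 ∣ s ^ 2 + 2 * r ^ 2) : 167 ∣ s ∧ 167 ∣ r := by
  haveI : Fact (Nat.Prime 167) := ⟨by norm_num⟩
  have hz : ((s : ZMod 167)) ^ 2 + 2 * ((r : ZMod 167)) ^ 2 = 0 := by
    have := (ZMod.natCast_eq_zero_iff (s ^ 2 + 2 * r ^ 2) 167).mpr h
    push_cast at this
    exact this
  have hr : (r : ZMod 167) = 0 := by
    by_contra hr
    have hsq : ((s : ZMod 167) * (r : ZMod 167)⁻¹) ^ 2 = -2 := by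
      have hr2 : ((r : ZMod 167)) ^ 2 ≠ 0 := pow_ne_zero _ hr
      field_simp
      linear_combination hz
    exact neg_two_nonsquare_mod_167 _ hsq
  have hs : (s : ZMod 167) = 0 := by
    rw [hr] at hz
    have : ((s : ZMod 167)) ^ 2 = 0 := by linear_combination hz
    exact pow_eq_zero_iff (n := 2) (by norm_num) |>.mp this
  exact ⟨(ZMod.natCast_eq_zero_iff s 167).mp hs, (ZMod.natCast_eq_zero_iff r 167).mp hr⟩

/-- **`v₁₆₇(s² + 2r²)` is even** for `s² + 2r² > 0`. -/
theorem even_padicValNat_sq_add_two_sq : ∀ K : ℕ, ∀ s r : ℕ, K = s ^ 2 + 2 * r ^ 2 → 0 < K →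
    Even (padicValNat 167 K) := by
  haveI : Fact (Nat.Prime 167) := ⟨by norm_num⟩
  intro K
  induction K using Nat.strong_induction_on with
  | _ K ih =>
    intro s r hK hpos
    by_cases h167 : 167 ∣ K
    · rw [hK] at h167
      obtain ⟨⟨s', hs'⟩, ⟨r', hr'⟩⟩ := dvd_of_dvd_sq_add_two_sq h167
      set K' := s' ^ 2 + 2 * r' ^ 2 with hK'
      have hKK' : K = 167 ^ 2 * K' := by rw [hK, hs', hr', hK']; ring
      have hK'pos : 0 < K' := by
        rcases Nat.eq_zero_or_pos K' with h0 | h0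
        · rw [hKK', h0, mul_zero] at hpos; exact absurd hpos (lt_irrefl 0)
        · exact h0
      have hlt : K' < K := by rw [hKK']; nlinarith
      have hev := ih K' hlt s' r' hK' hK'pos
      rw [hKK', padicValNat.mul (by norm_num) hK'pos.ne', padicValNat.prime_pow]
      exact (Nat.even_add.mpr (by simp [hev]))
    · rw [padicValNat.eq_zero_of_not_dvd h167]
      exact Even.zero

/-- `334` is not a sum of two natural squares -/
theorem not_sq_add_sq_334_nat : ¬ ∃ x y : ℕ, 334 = x ^ 2 + y ^ 2 := by
  rintro ⟨x, y, h⟩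
  have hx : x ≤ 19 := by nlinarith
  have hy : y ≤ 19 := by nlinarith
  interval_cases x <;> interval_cases y <;> omega

/-- `padicValNat 167 668 = 1` -/
theorem padicValNat_167_668 : padicValNat 167 668 = 1 := by
  haveI : Fact (Nat.Prime 167) := ⟨by norm_num⟩
  have h : (668 : ℕ) = 167 * 4 := by norm_num
  rw [h, padicValNat.mul (by norm_num) (by norm_num), padicValNat_self,
    padicValNat.eq_zero_of_not_dvd (by norm_num)]

/-- **The norm obstruction**: no `a, b, c, d ∈ ℚ` with `ab + cd = 0` and `a² + c² + 2(b² + d²) = 668`, i.e. `668` is not of the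
form `u² + v²` with `u = a + b√2`, `v = c + d√2`. -/
theorem rat_norm_obstruction_668 :
    ¬ ∃ a b c d : ℚ, a * b + c * d = 0 ∧ a ^ 2 + c ^ 2 + 2 * (b ^ 2 + d ^ 2) = 668 := by
  haveI : Fact (Nat.Prime 167) := ⟨by norm_num⟩
  rintro ⟨a, b, c, d, h1, h2⟩
  by_cases hac : a = 0 ∧ c = 0
  · -- then `b² + d² = 334`
    obtain ⟨ha, hc⟩ := hac
    have h334 : b ^ 2 + d ^ 2 = ((334 : ℕ) : ℚ) := by
      rw [ha, hc] at h2; push_cast; linarith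
    exact not_sq_add_sq_334_nat (nat_eq_sq_add_sq_of_rat h334)
  · -- `m = a² + c² > 0`, `(b, d) = t · (−c, a)`, `668 = m (1 + 2t²)`
    set m : ℚ := a ^ 2 + c ^ 2 with hm
    have hm0 : m ≠ 0 := by
      intro h0
      have ha : a = 0 := by nlinarith [sq_nonneg a, sq_nonneg c]
      have hc : c = 0 := by nlinarith [sq_nonneg a, sq_nonneg c]
      exact hac ⟨ha, hc⟩
    set t : ℚ := (a * d - b * c) / m with ht
    have hb : b = -t * c := by
      have e1 : b * m = -c * (a * d - b * c) := by rw [hm]; linear_combination a * h1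
      rw [ht]; field_simp; linear_combination e1
    have hd : d = t * a := by
      have e1 : d * m = a * (a * d - b * c) := by rw [hm]; linear_combination c * h1
      rw [ht]; field_simp; linear_combination e1
    have hkey : m * (1 + 2 * t ^ 2) = 668 := by
      rw [hm]; rw [hb, hd] at h2; linear_combination h2
    -- `668 (1 + 2t²) = (a (1 + 2t²))² + (c (1 + 2t²))²`, clear the denominator of `t`
    set U : ℚ := a * (1 + 2 * t ^ 2) * t.den with hU
    set V : ℚ := c * (1 + 2 * t ^ 2) * t.den with hV
    set K : ℕ := t.den ^ 2 + 2 * t.num.natAbs ^ 2 with hK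
    have htnum : (t.num : ℚ) = t * t.den := by rw [Rat.mul_den_eq_num]
    have hnumsq : ((t.num.natAbs : ℕ) : ℚ) ^ 2 = (t.num : ℚ) ^ 2 := by
      rw [Nat.cast_natAbs, Int.cast_abs, sq_abs]
    have hkey' : (a ^ 2 + c ^ 2) * (1 + 2 * t ^ 2) = 668 := by rw [← hm]; exact hkey
    have hUV : U ^ 2 + V ^ 2 = ((668 * K : ℕ) : ℚ) := by
      have eK : ((668 * K : ℕ) : ℚ) = 668 * ((t.den : ℚ) ^ 2 + 2 * (t.num : ℚ) ^ 2) := by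
        rw [hK]; push_cast; rw [← hnumsq]
      rw [eK, htnum, hU, hV]
      linear_combination ((1 + 2 * t ^ 2) * (t.den : ℚ) ^ 2) * hkey'
    obtain ⟨x, y, hxy⟩ := nat_eq_sq_add_sq_of_rat hUV
    have hKpos : 0 < K := by
      have := t.den_pos
      rw [hK]; positivity
    have hsq : ∃ x y, 668 * K = x ^ 2 + y ^ 2 := ⟨x, y, hxy⟩
    rw [Nat.eq_sq_add_sq_iff] at hsq
    have hmem : 167 ∈ (668 * K).primeFactors :=
      Nat.mem_primeFactors.mpr ⟨by norm_num, dvd_mul_of_dvd_left (by norm_num) _, by positivity⟩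
    have hev := hsq 167 hmem (by norm_num)
    rw [padicValNat.mul (by norm_num) hKpos.ne', padicValNat_167_668] at hev
    have hevK := even_padicValNat_sq_add_two_sq K t.den t.num.natAbs hK hKpos
    have : Even 1 := (Nat.even_add.mp hev).mpr hevK
    exact Nat.not_even_one this

/-- `√2 ∉ ℚ`: no rational `r` with `r² = 2 + 0·r` — the field condition for `QuadraticAlgebra ℚ 2 0 = ℚ(√2)`. -/
theorem sqrtTwo_irrational_fact : ∀ r : ℚ, r ^ 2 ≠ 2 + 0 * r := by
  intro r h
  rw [zero_mul, add_zero] at h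
  have hR : ((r : ℝ)) ^ 2 = 2 := by exact_mod_cast h
  have hs : Real.sqrt 2 = |(r : ℝ)| := by
    rw [← hR, Real.sqrt_sq_eq_abs]
  have : Real.sqrt 2 = ((|r| : ℚ) : ℝ) := by rw [hs]; push_cast; rfl
  exact irrational_sqrt_two.ne_rat |r| this

/-- `ℚ(√2)` as a field: the `Fact` that makes `QuadraticAlgebra ℚ 2 0` (`ω² = 2`) a field (use with `haveI`). -/
theorem sqrtTwo_field_fact : Fact (∀ r : ℚ, r ^ 2 ≠ 2 + 0 * r) := ⟨sqrtTwo_irrational_fact⟩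

/-- **`668` is not a sum of two squares in `ℚ(√2)`.** -/
theorem not_sum_two_sq_668_sqrtTwo : ¬ ∃ u v : QuadraticAlgebra ℚ 2 0, u ^ 2 + v ^ 2 = 668 := by
  rintro ⟨u, v, h⟩
  have hre := congrArg QuadraticAlgebra.re h
  have him := congrArg QuadraticAlgebra.im h
  simp only [sq, QuadraticAlgebra.re_add, QuadraticAlgebra.re_mul, QuadraticAlgebra.im_add, QuadraticAlgebra.im_mul,
    QuadraticAlgebra.re_ofNat, QuadraticAlgebra.im_ofNat] at hre him
  refine rat_norm_obstruction_668 ⟨u.re, u.im, v.re, v.im, ?_, ?_⟩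
  · linear_combination him / 2
  · linear_combination hre

end Summit.Ventures.DiscreteObjects.Hadamard
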